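import Summits.Parity.GeneralizedHardyLittlewood.Theorems.LeeYangFibresFibrationLemmaBounds
import HarnessLib

/-!
# Fibration lemma (`DimOne → GeneralizedHardyLittlewood`), part 8: the `L¹` bound for the tail exponents

Support file for the statement item `FibrationLemma : DimOne → GeneralizedHardyLittlewood`
(Green–Tao 2010, §1, remark after Conj. 1.2). The tail ratio of the fibre system over a base point
`w` is controlled by `R(w) ≤ exp(X(w))` (part 6), where `X(w)` sums `(t-1)/(p-t)` over the primes
`p > z` at which `w` is non-generic. Pointwise `X(w)` is only `O(1)`; what makes the fibre main terms
average correctly is that `X` is small in `L¹` over the box: a prime `p` is non-generic for `w` only if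
`p ∣ Dᵢⱼ(w)` for a NON-PARALLEL pair, which happens for `O(N^d/p + N^{d-1})` base points
(`card_filter_dvd_eval_le`, part 3). Summing `(t-1)/(p-t) ≪ t/p` against this count over
`z < p ≤ D_max` (larger primes cannot divide a non-zero discriminant, part 6) gives

  `∑_{w good} X(w) ≤ 2t³ (2N+1)^{d-1} (2 D_max / z + log log D_max + 4)`     (`sum_goodSet_tailX_le`),

with `D_max = 2L²(d+1)N` (`discMax`), using `∑_{p>z} p⁻² ≤ 1/z` and Mertens' `∑_{p≤y} 1/p ≤ log log y + 4`
(tree: `MertensBound.sum_inv_prime_le`).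
-/

noncomputable section

open Finset

namespace Summit.Parity.GeneralizedHardyLittlewood.Theorems

open Literature.NumberTheory.Sieve
open Literature.NumberTheory.LFunctions.MertensBound (sum_inv_prime_le)

variable {d t : ℕ}

/-- `D_max = 2 L² (d+1) N`, the bound for the discriminants on the box (`abs_discForm_eval_le`). [folklore] -/
def discMax (d L N : ℕ) : ℕ := 2 * L * L * (d + 1) * N

/-- `D_max ≥ 2` for `L, N ≥ 1`. [folklore] -/
theorem two_le_discMax {L N : ℕ} (hL : 1 ≤ L) (hN : 1 ≤ N) (d : ℕ) : 2 ≤ discMax d L N := by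
  unfold discMax
  calc 2 = 2 * 1 * 1 * 1 * 1 := by ring
    _ ≤ 2 * L * L * (d + 1) * N := by gcongr; omega

section

variable {Ψ : Fin t → AffLinForm (d + 1)} {L N z : ℕ}

/-- On the box the discriminants are bounded by `D_max`. [folklore] -/
theorem abs_discForm_eval_le_discMax (hL : ∀ i j, ((Ψ i).coeff j).natAbs ≤ L)
    (hc : ∀ i, (Ψ i).const.natAbs ≤ L * N) {w : Fin d → ℤ} (hw : w ∈ latticeBox d N) (i j : Fin t) :
    |(discForm Ψ i j).eval w| ≤ (discMax d L N : ℕ) :=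
  abs_discForm_eval_le hL hc hw i j

open Classical in
/-- **Few base points are non-generic at a given large prime**: at most
`t² (2 (D_max/p) + 1) (2N+1)^{d-1}` points of the box. [cite: GreenTao2010, proof of Lemma 1.3] -/
theorem card_box_not_mem_genericSet_le (hL : ∀ i j, ((Ψ i).coeff j).natAbs ≤ L)
    (hc : ∀ i, (Ψ i).const.natAbs ≤ L * N) {p : ℕ} (hp : 1 ≤ p) :
    #{w ∈ latticeBox d N | w ∉ genericSet Ψ p} ≤
      t * t * ((2 * (discMax d L N / p) + 1) * (2 * N + 1) ^ (d - 1)) := by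
  have hsub : ({w ∈ latticeBox d N | w ∉ genericSet Ψ p} : Finset _) ⊆
      (((univ : Finset (Fin t)).offDiag).filter fun ij => (discForm Ψ ij.1 ij.2).coeff ≠ 0).biUnion
        fun ij => {w ∈ latticeBox d N | (p : ℤ) ∣ (discForm Ψ ij.1 ij.2).eval w} := by
    intro w hw
    obtain ⟨hbox, hng⟩ := Finset.mem_filter.mp hw
    rw [mem_genericSet] at hng
    push Not at hng
    obtain ⟨i, j, hij, hcoef, hdvd⟩ := hng
    exact Finset.mem_biUnion.mpr ⟨(i, j), Finset.mem_filter.mpr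
      ⟨Finset.mem_offDiag.mpr ⟨Finset.mem_univ _, Finset.mem_univ _, hij⟩, hcoef⟩,
      Finset.mem_filter.mpr ⟨hbox, hdvd⟩⟩
  calc _ ≤ _ := Finset.card_le_card hsub
    _ ≤ ∑ ij ∈ ((univ : Finset (Fin t)).offDiag).filter fun ij => (discForm Ψ ij.1 ij.2).coeff ≠ 0,
          #{w ∈ latticeBox d N | (p : ℤ) ∣ (discForm Ψ ij.1 ij.2).eval w} := Finset.card_biUnion_le
    _ ≤ ∑ _ij ∈ ((univ : Finset (Fin t)).offDiag).filter fun ij => (discForm Ψ ij.1 ij.2).coeff ≠ 0,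
          (2 * (discMax d L N / p) + 1) * (2 * N + 1) ^ (d - 1) := by
        refine Finset.sum_le_sum fun ij hij => ?_
        have hcoef : (discForm Ψ ij.1 ij.2).coeff ≠ 0 := (Finset.mem_filter.mp hij).2
        obtain ⟨k, hk⟩ : ∃ k, (discForm Ψ ij.1 ij.2).coeff k ≠ 0 := by
          by_contra h
          push Not at h
          exact hcoef (funext h)
        exact card_filter_dvd_eval_le _ hk N hp fun w hw => abs_discForm_eval_le_discMax hL hc hw _ _
    _ ≤ t * t * ((2 * (discMax d L N / p) + 1) * (2 * N + 1) ^ (d - 1)) := by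
        rw [Finset.sum_const, smul_eq_mul]
        refine Nat.mul_le_mul_right _ ?_
        calc _ ≤ #((univ : Finset (Fin t)).offDiag) := Finset.card_filter_le _ _
          _ = t * t - t := by rw [Finset.offDiag_card, Finset.card_univ, Fintype.card_fin]
          _ ≤ t * t := Nat.sub_le _ _

/-- The exponent coefficient: `(t-1)/(p-t) ≤ 2t/p` for `p > 2t`. [folklore] -/
theorem coeff_le_two_mul_div {p : ℕ} (ht : 1 ≤ t) (hpt : 2 * t < p) :
    ((t : ℝ) - 1) / ((p : ℝ) - t) ≤ 2 * (t : ℝ) / p := by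
  have ht1 : (1 : ℝ) ≤ t := by exact_mod_cast ht
  have hpt' : (2 * t : ℝ) < p := by exact_mod_cast hpt
  have hp0 : (0 : ℝ) < p := by linarith
  rw [div_le_div_iff₀ (by linarith) hp0]
  nlinarith

open Classical in
/-- **The `L¹` bound for the tail exponents over the good base points**:
`∑_{w ∈ goodSet} X_{z,x}(w) ≤ 2t³ (2N+1)^{d-1} (2 D_max/z + log log D_max + 4)` for every `x`.
[cite: GreenTao2010, §1 (remark after Conj. 1.2)] -/
theorem sum_goodSet_tailX_le (hL : ∀ i j, ((Ψ i).coeff j).natAbs ≤ L) (ha : ∀ i, lastCoeff (Ψ i) ≠ 0)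
    (hc : ∀ i, (Ψ i).const.natAbs ≤ L * N) (ht : 1 ≤ t) (hz : tailThreshold t L ≤ z) (hz1 : 1 ≤ z)
    (hN : 1 ≤ N) (x : ℕ) :
    ∑ w ∈ goodSet Ψ N, tailX Ψ z x w ≤
      2 * (t : ℝ) ^ 3 * (2 * N + 1 : ℝ) ^ (d - 1) *
        (2 * (discMax d L N : ℝ) / z + Real.log (Real.log (discMax d L N)) + 4) := by
  set D := discMax d L N with hDdef
  have hL1 := one_le_of_coeff_bound hL ha ht
  have hD2 : 2 ≤ D := two_le_discMax hL1 hN d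
  have hDr : (2 : ℝ) ≤ D := by exact_mod_cast hD2
  set T := tailPrimes z D with hT
  -- Step 1: replace `x` by `D` (monotonicity / insensitivity for good points)
  have h1 : ∑ w ∈ goodSet Ψ N, tailX Ψ z x w ≤ ∑ w ∈ goodSet Ψ N, tailX Ψ z D w := by
    refine Finset.sum_le_sum fun w hw => ?_
    rw [tailX_eq_of_mem_goodSet hw (fun i j => abs_discForm_eval_le_discMax hL hc (goodSet_subset Ψ N hw) i j)]
    exact tailX_mono ht hz (min_le_right _ _) w
  refine h1.trans ?_
  -- Step 2: swap the sums
  set c : ℕ → ℝ := fun p => ((t : ℝ) - 1) / ((p : ℝ) - t) with hcdef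
  have hswap : ∑ w ∈ goodSet Ψ N, tailX Ψ z D w =
      ∑ p ∈ T, c p * #{w ∈ goodSet Ψ N | w ∉ genericSet Ψ p} := by
    have : ∀ w ∈ goodSet Ψ N, tailX Ψ z D w = ∑ p ∈ T, if w ∉ genericSet Ψ p then c p else 0 := by
      intro w _
      unfold tailX
      rw [Finset.sum_filter]
    rw [Finset.sum_congr rfl this, Finset.sum_comm]
    refine Finset.sum_congr rfl fun p _ => ?_
    rw [← Finset.sum_filter, Finset.sum_const, nsmul_eq_mul, mul_comm]
  rw [hswap]
  -- Step 3: bound each prime's contribution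
  have hc0 : ∀ p ∈ T, 0 ≤ c p := fun p hp => by
    obtain ⟨-, -, hpt⟩ := large_of_mem_tailPrimes hz hp
    have h1' : (1 : ℝ) ≤ t := by exact_mod_cast ht
    have h2' : (2 * t : ℝ) < p := by exact_mod_cast hpt
    exact div_nonneg (by linarith) (by linarith)
  have hterm : ∀ p ∈ T, c p * #{w ∈ goodSet Ψ N | w ∉ genericSet Ψ p} ≤
      2 * (t : ℝ) ^ 3 * (2 * N + 1 : ℝ) ^ (d - 1) * (2 * (D : ℝ) * ((p : ℝ) ^ 2)⁻¹ + (1 : ℝ) / p) := by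
    intro p hp
    obtain ⟨hprime, hpL, hpt⟩ := large_of_mem_tailPrimes hz hp
    have hp0 : (0 : ℝ) < p := by exact_mod_cast hprime.pos
    have hp1 : 1 ≤ p := hprime.one_le
    -- count: good non-generic ⊆ box non-generic
    have hcount : (#{w ∈ goodSet Ψ N | w ∉ genericSet Ψ p} : ℝ) ≤
        t * t * ((2 * (D / p : ℕ) + 1) * (2 * N + 1) ^ (d - 1) : ℕ) := by
      have h1 : #{w ∈ goodSet Ψ N | w ∉ genericSet Ψ p} ≤ #{w ∈ latticeBox d N | w ∉ genericSet Ψ p} :=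
        Finset.card_le_card (Finset.filter_subset_filter _ (goodSet_subset Ψ N))
      have h2 := card_box_not_mem_genericSet_le (d := d) (Ψ := Ψ) hL hc hp1
      exact_mod_cast h1.trans h2
    have hdiv : (((D / p : ℕ) : ℕ) : ℝ) ≤ (D : ℝ) / p := Nat.cast_div_le
    have hcp : c p ≤ 2 * (t : ℝ) / p := coeff_le_two_mul_div ht hpt
    have hN1 : (0 : ℝ) ≤ (2 * N + 1 : ℝ) ^ (d - 1) := by positivity
    calc c p * #{w ∈ goodSet Ψ N | w ∉ genericSet Ψ p}
        ≤ (2 * (t : ℝ) / p) * (t * t * ((2 * ((D : ℝ) / p) + 1) * (2 * N + 1 : ℝ) ^ (d - 1))) := by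
          refine mul_le_mul hcp (hcount.trans ?_) (Nat.cast_nonneg _) (by positivity)
          push_cast
          gcongr
      _ = 2 * (t : ℝ) ^ 3 * (2 * N + 1 : ℝ) ^ (d - 1) * (2 * (D : ℝ) * ((p : ℝ) ^ 2)⁻¹ + 1 / p) := by
          field_simp
  refine (Finset.sum_le_sum hterm).trans ?_
  rw [← Finset.mul_sum, Finset.sum_add_distrib, ← Finset.mul_sum]
  -- Step 4: the two prime sums
  have hsq : ∑ p ∈ T, ((p : ℝ) ^ 2)⁻¹ ≤ (z : ℝ)⁻¹ :=
    (Finset.sum_le_sum_of_subset_of_nonneg (tailPrimes_subset_Ioc z D) fun _ _ _ => by positivity).trans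
      (sum_Ioc_inv_sq_le hz1 D)
  have hinv : ∑ p ∈ T, (1 : ℝ) / p ≤ Real.log (Real.log D) + 4 := by
    refine le_trans ?_ (sum_inv_prime_le D hD2)
    refine Finset.sum_le_sum_of_subset_of_nonneg (fun p hp => ?_) fun _ _ _ => by positivity
    rw [hT, mem_tailPrimes] at hp
    exact Nat.mem_primesLE.mpr ⟨hp.2.2, hp.1⟩
  have hpre : (0 : ℝ) ≤ 2 * (t : ℝ) ^ 3 * (2 * N + 1 : ℝ) ^ (d - 1) := by positivity
  refine mul_le_mul_of_nonneg_left ?_ hpre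
  calc 2 * (D : ℝ) * ∑ p ∈ T, ((p : ℝ) ^ 2)⁻¹ + ∑ p ∈ T, (1 : ℝ) / p
      ≤ 2 * (D : ℝ) * (z : ℝ)⁻¹ + (Real.log (Real.log D) + 4) :=
        add_le_add (mul_le_mul_of_nonneg_left hsq (by positivity)) hinv
    _ = 2 * (D : ℝ) / z + Real.log (Real.log D) + 4 := by rw [div_eq_mul_inv]; ring

/-! ### The pointwise bound for the tail exponents -/

/-- **Few large prime factors**: if the primes of `s` are distinct, all `> z` and all divide `M ≠ 0`,
then `#s · log(z+1) ≤ log M`. [folklore] -/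
theorem card_mul_log_le_log {M z : ℕ} (hM : M ≠ 0) (s : Finset ℕ)
    (hs : ∀ p ∈ s, p.Prime ∧ z < p ∧ p ∣ M) : (#s : ℝ) * Real.log ((z : ℝ) + 1) ≤ Real.log M := by
  have hprod : ∏ p ∈ s, p ∣ M :=
    Finset.prod_primes_dvd M (fun p hp => (hs p hp).1.prime) (fun p hp => (hs p hp).2.2)
  have hle : ∏ p ∈ s, p ≤ M := Nat.le_of_dvd (Nat.pos_of_ne_zero hM) hprod
  have hpow : (z + 1) ^ #s ≤ ∏ p ∈ s, p :=
    Finset.pow_card_le_prod s (fun p => p) (z + 1) (fun p hp => (hs p hp).2.1)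
  have h1 : ((z : ℝ) + 1) ^ #s ≤ M := by exact_mod_cast hpow.trans hle
  have := Real.log_le_log (by positivity) h1
  rwa [Real.log_pow] at this

/-- `X_max = 2t³ log D_max / (z log z)`. [folklore] -/
def tailXmax (t Dmax z : ℕ) : ℝ := 2 * (t : ℝ) ^ 3 * Real.log Dmax / ((z : ℝ) * Real.log z)

open Classical in
/-- **The pointwise bound `X(w) ≤ X_max` at a good base point**: at most `t² log D_max / log z`
primes `> z` divide the discriminant product of `w`, and each contributes `≤ 2t/z`.
[cite: GreenTao2010, §1 (remark after Conj. 1.2)] -/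
theorem tailX_le_tailXmax (hL : ∀ i j, ((Ψ i).coeff j).natAbs ≤ L) (ha : ∀ i, lastCoeff (Ψ i) ≠ 0)
    (hc : ∀ i, (Ψ i).const.natAbs ≤ L * N) (ht : 1 ≤ t) (hz : tailThreshold t L ≤ z) (hz2 : 2 ≤ z)
    (hN : 1 ≤ N) (x : ℕ) {w : Fin d → ℤ} (hw : w ∈ goodSet Ψ N) :
    tailX Ψ z x w ≤ tailXmax t (discMax d L N) z := by
  set D := discMax d L N with hDdef
  have hL1 := one_le_of_coeff_bound hL ha ht
  have hD2 : 2 ≤ D := two_le_discMax hL1 hN d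
  have hD1 : 1 ≤ D := by omega
  have hDr : (2 : ℝ) ≤ D := by exact_mod_cast hD2
  have hzr : (2 : ℝ) ≤ z := by exact_mod_cast hz2
  have hlogz : 0 < Real.log z := Real.log_pos (by linarith)
  have hM : ∀ i j, |(discForm Ψ i j).eval w| ≤ (D : ℕ) := fun i j =>
    abs_discForm_eval_le_discMax hL hc (goodSet_subset Ψ N hw) i j
  -- reduce to `x = D`
  have h1 : tailX Ψ z x w ≤ tailX Ψ z D w := by
    rw [tailX_eq_of_mem_goodSet hw hM]
    exact tailX_mono ht hz (min_le_right _ _) w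
  refine h1.trans ?_
  unfold tailX
  set S := (tailPrimes z D).filter (fun p => w ∉ genericSet Ψ p) with hS
  -- each term is `≤ 2t/z`
  have hterm : ∀ p ∈ S, ((t : ℝ) - 1) / ((p : ℝ) - t) ≤ 2 * (t : ℝ) / z := by
    intro p hp
    obtain ⟨hprime, -, hpt⟩ := large_of_mem_tailPrimes hz (Finset.mem_filter.mp hp).1
    have hzp : z < p := (mem_tailPrimes.mp (Finset.mem_filter.mp hp).1).2.1
    refine (coeff_le_two_mul_div ht hpt).trans ?_
    have hzp' : (z : ℝ) ≤ p := by exact_mod_cast hzp.le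
    exact div_le_div_of_nonneg_left (by positivity) (by linarith) hzp'
  -- the number of terms
  have hcard : (#S : ℝ) * Real.log ((z : ℝ) + 1) ≤ (t * t : ℕ) * Real.log D := by
    have hM0 : discProd Ψ w ≠ 0 := discProd_ne_zero hw
    have h2 := card_mul_log_le_log hM0 S fun p hp => by
      obtain ⟨hp1, hng⟩ := Finset.mem_filter.mp hp
      obtain ⟨hprime, hzp, -⟩ := mem_tailPrimes.mp hp1
      rw [mem_genericSet] at hng
      push Not at hng
      obtain ⟨i, j, hij, -, hdvd⟩ := hng
      exact ⟨hprime, hzp, dvd_discProd_of_dvd hij hdvd⟩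
    refine h2.trans ?_
    have h3 : (discProd Ψ w : ℝ) ≤ (D : ℝ) ^ (t * t) := by exact_mod_cast discProd_le hD1 hM
    have h4 := Real.log_le_log (by exact_mod_cast Nat.pos_of_ne_zero hM0) h3
    rw [Real.log_pow] at h4
    exact_mod_cast h4
  have hlogz1 : Real.log z ≤ Real.log ((z : ℝ) + 1) := Real.log_le_log (by linarith) (by linarith)
  have hcard' : (#S : ℝ) ≤ (t * t : ℕ) * Real.log D / Real.log z := by
    rw [le_div_iff₀ hlogz]
    calc (#S : ℝ) * Real.log z ≤ #S * Real.log ((z : ℝ) + 1) :=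
          mul_le_mul_of_nonneg_left hlogz1 (Nat.cast_nonneg _)
      _ ≤ _ := hcard
  calc ∑ p ∈ S, ((t : ℝ) - 1) / ((p : ℝ) - t) ≤ ∑ _p ∈ S, 2 * (t : ℝ) / z := Finset.sum_le_sum hterm
    _ = #S * (2 * (t : ℝ) / z) := by rw [Finset.sum_const, nsmul_eq_mul]
    _ ≤ ((t * t : ℕ) * Real.log D / Real.log z) * (2 * (t : ℝ) / z) :=
        mul_le_mul_of_nonneg_right hcard' (by positivity)
    _ = tailXmax t D z := by
        unfold tailXmax
        push_cast
        field_simp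

end

end Summit.Parity.GeneralizedHardyLittlewood.Theorems
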